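import Mathlib.Data.Finite.Perm
import Mathlib.Algebra.GroupWithZero.Units.Fintype
import Mathlib.Data.Nat.Factorial.Basic
import Literature.IUT.HodgeTheaters.Labels
import Literature.IUT.HodgeTheaters.LabelsPlusMinus
import HarnessLib

/-!
# [IUTchI] §6, Remark 6.12.4: synchronization of labels, `ζ`- and `ξ`-bijections

Mochizuki, *Inter-universal Teichmüller theory I: construction of Hodge theaters*, §6 "Additive
Combinatorial Teichmüller Theory", Remark 6.12.4 (i)–(iv), kurims manuscript (May 2020) pp. 177–179
[claim: Mochizuki2012, status: disputed] — abc-iut cell, layer L5, row W2-L5-03a (sibling of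
`PMTheatersRemarksA.lean` = Remark 6.12.3; Remarks 6.12.5–6.12.6 are abc-iut-L5-t7's).

Remark 6.12.4 is EXPOSITORY; its sub-items are recorded as follows (namespace `Rmk6124`).

* **(i)** p. 177 — NOTED (prose): like the `𝔽_l^⋇`-symmetry of Prop. 4.9 (i), the `𝔽_l^{⋊±}`-symmetry of
  Prop. 6.8 (i) will be applied in [IUTchII], [IUTchIII] "to establish an explicit network of comparison
  isomorphisms relating various objects — such as log-volumes — associated to the non-labeled
  prime-strips that are permuted by this symmetry" (cf. Rmk. 4.9.1 (i)); this network "operates without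
  'label crushing' [cf. Remark 4.9.2, (i)] — i.e., without disturbing the bijective relationship between
  the set of indices of the symmetrized collection of prime-strips and the set of labels `∈ T ⥲ 𝔽_l`";
  "this crucial synchronization of labels is essentially a consequence of the single connected component
  — or, at a more abstract level, the single basepoint — of the global object [`†𝒟^{⊚±}` in §6; `†𝒟^⊚`
  in §4]" (cf. Rmk. 4.9.2 (ii)). Cross-references Rmk. 4.9.1/4.9.2 are abc-iut-L3-t10's nodes
  (`BaseRemarks*.lean`); nothing checkable is asserted here beyond them.
* **(ii)** pp. 177–179 — the bijections `†ζ_⋆ : LabCusp(†𝒟^⊚) ⥲ J` (Prop. 4.7 (iii); abc-iut-L5-t3's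
  `Prop47iii` in `BaseHodgeTheaters.lean`, TODO-merge:abc-iut-L5-t3) and
  `†ζ_± : LabCusp^±(†𝒟^{⊚±}) ⥲ T` (Prop. 6.5 (iii); abc-iut-L5-t4's `PMBaseKit.DThetaPMEllHT.ZetaPMInvSpec`
  in `PMBaseBridgeProps.lean`, TODO-merge:abc-iut-L5-t4) "realize" the synchronization of (i); NOTED as
  cross-references. TYPED AND PROVED (the checkable kernel of the second paragraph): "it is precisely the
  existence of these bijections relating index sets of capsules of `𝒟`-prime-strips to sets of global
  [`±`-]label classes of cusps that distinguishes the finer 'combinatorially holomorphic' `𝔽_l^⋇`-,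
  `𝔽_l^{⋊±}`-symmetries of Props. 4.9 (i), 6.8 (i) from the coarser 'combinatorially real analytic'
  `𝔖_l^⋇`-, `𝔖_l^±`-symmetries of Props. 4.9 (ii), (iii), 6.8 (ii), (iii) — i.e., which do not admit a
  compatible bijection between the index sets of the capsules involved and some sort of set of
  [`±`-]label classes of cusps": for NO bijection of an index set `T` with the `𝔽_l^±`-torsor `𝔽_l`
  (resp. of `J` with the `𝔽_l^⋇`-torsor `𝔽_l^⋇`) does every permutation of `T` (resp. `J`) act through
  `𝔽_l^{⋊±}` (resp. `𝔽_l^⋇`) — `no_perm_compatible_equiv_pm` (`l ≥ 4`), `no_perm_compatible_equiv_star`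
  (`l ≥ 7`), by counting: `|𝔖_l| = l! > 2l = |𝔽_l^{⋊±}|` (`card_flPM_lt_card_perm`),
  `|𝔖_{l^⋇}| = l^⋇! > l^⋇ = |𝔽_l^⋇|`. (For `l = 5` one has `l^⋇ = 2` and the `𝔽_5^⋇`- and
  `𝔖_2`-symmetries of a `2`-element index set coincide as permutation groups; the printed distinction is
  about compatibility with cusp labels, which the counting kernel captures only for `l^⋇ ≥ 3`.) NOTED: the
  role of this relationship in the Hodge-Arakelov-theoretic evaluation of [IUTchII].
* **(iii)** p. 179 — TYPED AND PROVED: the "global `±`-synchronization" — the isomorphisms `†ξ` of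
  Prop. 6.5 (i), (ii) between the `±`-indeterminacies at the various `v ∈ 𝕍` (abc-iut-L5-t4's
  `DThetaEllBridge.XiGroupCompat`, `DThetaPMEllHT.XiPMEqXiEll`; TODO-merge:abc-iut-L5-t4) — "is a
  necessary 'pre-condition' [i.e., since the natural additive action of `𝔽_l` on `𝔽_l` is not compatible
  with the natural surjection `𝔽_l ↠ |𝔽_l|`] for the additive portion [i.e., corresponding to
  `𝔽_l ⊆ 𝔽_l^{⋊±}`] of the `𝔽_l^{⋊±}`-symmetry of Proposition 6.8, (i)": the bracketed assertion is
  `transl_not_compatible_flAbs` (over abc-iut-L5-t3's `FlAbs = |𝔽_l|`, for `l ≥ 3`; it fails for `l = 2`,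
  where `−1 = 1`), with the elementary contrast that the multiplicative action of `𝔽_l^×` DOES descend to
  `|𝔽_l|` (`units_mul_compatible_flAbs`) and the criterion `flAbs_descends_iff` (a self-map of `𝔽_l`
  descends to `|𝔽_l|` iff it commutes with `−1` up to sign). NOTED: "this 'additive portion' of the
  `𝔽_l^{⋊±}`-symmetry plays the crucial role of allowing one to relate the zero and nonzero elements of
  `𝔽_l`" — the content of Rmk. 6.12.5 (i), abc-iut-L5-t7's node (not re-typed here).
* **(iv)** p. 179 — NOTED (prose): the `†ζ`'s of (ii) and the `†ξ`'s of (iii) "are constructed by means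
  of functorial algorithms from the intrinsic structure of a `𝒟-Θ^{±ell}`- or `𝒟-ΘNF`-Hodge theater
  [cf. Propositions 4.7, (iii); 6.5, (i), (ii), (iii)] — i.e., not by means of comparison with some fixed
  reference model [cf. [AbsTopIII], §I4], such as the objects constructed in Examples 4.3, 4.4, 4.5, 6.2,
  6.3"; this "will be of crucial importance" when combined with the log-shells of [AbsTopIII] in
  [IUTchIII]. (In the typed record this is reflected by the SHAPE of the cited declarations — `Prop47iii`,
  `InducesZeta`, `ZetaPMInvSpec` are `∃!`/specification statements about an arbitrary Hodge theater, not
  comparisons with `Ex62`/`Ex63` models — and carries no further checkable content.)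

Everything proved here is finite combinatorics of `𝔽_l = ZMod l`; the claim-form tags record that the
STATEMENTS transcribe sentences of [IUTchI]. Nothing here takes a side on [IUTchIII] Cor. 3.12.
-/

namespace Literature.IUT.HodgeTheaters

namespace Rmk6124

open scoped Nat

variable (l : ℕ)

/-! ### Remark 6.12.4 (ii): index sets of capsules vs. sets of `[±]`-label classes of cusps -/

/-- `|𝔽_l^{⋊±}| = 2l` (the order of the `𝔽_l^{⋊±}`-symmetry group of [IUTchI] Def. 6.1 (i), Prop. 6.8 (i);
used in Rmk. 6.12.4 (ii) p. 178). [claim: Mochizuki2012, status: disputed] -/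
theorem card_flPM [NeZero l] : Nat.card (FlPM l) = l * 2 := by
  rw [show Nat.card (FlPM l) = Nat.card (Multiplicative (ZMod l)) * Nat.card ℤˣ from
    SemidirectProduct.card]
  rw [Nat.card_eq_fintype_card, Nat.card_eq_fintype_card, Fintype.card_multiplicative, ZMod.card,
    Fintype.card_units_int]

/-- `|𝔖_l| = l!` (the order of the `𝔖_l^±`-symmetry group of [IUTchI] Prop. 6.8 (ii), all permutations of
the `l`-element index set `T ≅ 𝔽_l`; used in Rmk. 6.12.4 (ii) p. 178). [claim: Mochizuki2012, status: disputed] -/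
theorem card_perm_zmod [NeZero l] : Nat.card (Equiv.Perm (ZMod l)) = l ! := by
  rw [Nat.card_perm, Nat.card_eq_fintype_card, ZMod.card]

/-- `2·l < l!` for `l ≥ 4`. [folklore] -/
private theorem two_mul_lt_factorial {l : ℕ} (hl : 4 ≤ l) : l * 2 < l ! := by
  obtain ⟨k, rfl⟩ := Nat.exists_eq_add_of_le hl
  rw [show 4 + k = (k + 3) + 1 by ring, Nat.factorial_succ]
  have h6 : 6 ≤ (k + 3)! := by
    calc 6 = 3 ! := rfl
      _ ≤ (k + 3)! := Nat.factorial_le (by omega)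
  nlinarith

/-- [IUTchI] Rmk. 6.12.4 (ii) p. 178–179, counting kernel: the `𝔖_l^±`-symmetry is strictly COARSER than
the `𝔽_l^{⋊±}`-symmetry — `|𝔽_l^{⋊±}| = 2l < l! = |𝔖_l|` for `l ≥ 4` (in IUT `l ≥ 5`, Def. 3.1 (c)).
[claim: Mochizuki2012, status: disputed] -/
theorem card_flPM_lt_card_perm [NeZero l] (hl : 4 ≤ l) :
    Nat.card (FlPM l) < Nat.card (Equiv.Perm (ZMod l)) := by
  rw [card_flPM, card_perm_zmod]; exact two_mul_lt_factorial hl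

/-- [IUTchI] Rmk. 6.12.4 (ii): not every permutation of `𝔽_l` is of the form `z ↦ ±z + λ` — the action
homomorphism `𝔽_l^{⋊±} → 𝔖(𝔽_l)` of Def. 6.1 (i) is not surjective (`l ≥ 4`). [claim: Mochizuki2012, status: disputed] -/
theorem toPerm_not_surjective (hl : 4 ≤ l) : ¬ Function.Surjective (FlPM.toPerm l) := by
  haveI : NeZero l := ⟨by omega⟩
  haveI : Finite (FlPM l) :=
    Finite.of_equiv (Multiplicative (ZMod l) × ℤˣ) SemidirectProduct.equivProd.symm
  intro h
  exact absurd (Nat.card_le_card_of_surjective _ h) (not_le.mpr (card_flPM_lt_card_perm l hl))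

/-- **[IUTchI] Rmk. 6.12.4 (ii) pp. 178–179** (the `±` case): the coarser "combinatorially real analytic"
`𝔖_l^±`-symmetry [arbitrary permutations of the index set `T` of the capsule, Prop. 6.8 (ii)] does "not
admit a compatible bijection between the index sets of the capsules involved and some sort of set of
`±`-label classes of cusps" [an `𝔽_l^±`-torsor, on which symmetries act through `𝔽_l^{⋊±}`, Def. 6.1
(i)]: for NO bijection `e : T ≃ 𝔽_l` does every permutation of `T` act through an element of `𝔽_l^{⋊±}`
(`l ≥ 4`) — whereas the `𝔽_l^{⋊±}`-symmetry of Prop. 6.8 (i) does, via `†ζ_±` of Prop. 6.5 (iii)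
(abc-iut-L5-t4 `ZetaPMInvSpec`). [claim: Mochizuki2012, status: disputed] -/
theorem no_perm_compatible_equiv_pm (hl : 4 ≤ l) {T : Type*} (e : T ≃ ZMod l) :
    ¬ ∀ σ : Equiv.Perm T, ∃ g : FlPM l, ∀ t : T, e (σ t) = g • e t := by
  intro h
  apply toPerm_not_surjective l hl
  intro π
  obtain ⟨g, hg⟩ := h (e.trans (π.trans e.symm))
  refine ⟨g, Equiv.ext fun z => ?_⟩
  have := hg (e.symm z)
  simp only [Equiv.trans_apply, Equiv.apply_symm_apply] at this
  rw [FlPM.toPerm_apply, ← this]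

/-- **[IUTchI] Rmk. 6.12.4 (ii) pp. 178–179** (the `⋇` case): the coarser `𝔖_l^⋇`-symmetry [arbitrary
permutations of the index set `J`, Prop. 4.9 (ii)] admits no bijection `e : J ≃ 𝔽_l^⋇` with the
`𝔽_l^⋇`-torsor of label classes of cusps under which every permutation of `J` acts through `𝔽_l^⋇`
[as the `𝔽_l^⋇`-symmetry of Prop. 4.9 (i) does via `†ζ_⋆` of Prop. 4.7 (iii), abc-iut-L5-t3 `Prop47iii`]
— by counting, `|𝔽_l^⋇| = l^⋇ < l^⋇! = |𝔖_{l^⋇}|` as soon as `l^⋇ ≥ 3`, i.e. for primes `l ≥ 7` (for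
`l = 5`, `l^⋇ = 2` and the two symmetry groups of the `2`-element set `J` coincide).
[claim: Mochizuki2012, status: disputed] -/
theorem no_perm_compatible_equiv_star [Fact l.Prime] (hl : 7 ≤ l) {J : Type*} (e : J ≃ FlStar l) :
    ¬ ∀ σ : Equiv.Perm J, ∃ g : FlStar l, ∀ j : J, e (σ j) = g * e j := by
  intro h
  have hsurj : Function.Surjective (MulAction.toPermHom (FlStar l) (FlStar l)) := by
    intro π
    obtain ⟨g, hg⟩ := h (e.trans (π.trans e.symm))
    refine ⟨g, Equiv.ext fun z => ?_⟩
    have := hg (e.symm z)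
    simp only [Equiv.trans_apply, Equiv.apply_symm_apply] at this
    rw [MulAction.toPermHom_apply, MulAction.toPerm_apply, smul_eq_mul, ← this]
  have hcard := Nat.card_le_card_of_surjective _ hsurj
  rw [Nat.card_perm, card_flStar l (by omega)] at hcard
  have h3 : 3 ≤ lStar l := by
    unfold lStar; omega
  exact absurd hcard (not_le.mpr (Nat.lt_factorial_self h3))

/-! ### Remark 6.12.4 (iii): the additive action of `𝔽_l` on `𝔽_l` does not descend to `|𝔽_l|` -/

/-- **[IUTchI] Rmk. 6.12.4 (iii) p. 179**: "the natural additive action of `𝔽_l` on `𝔽_l` is not compatible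
with the natural surjection `𝔽_l ↠ |𝔽_l|`" (`|𝔽_l| = 𝔽_l/{±1}`, abc-iut-L5-t3's `FlAbs`) — whence the
global `±`-synchronization `†ξ` of Prop. 6.5 (i), (ii) is "a necessary 'pre-condition'" for the additive
portion `𝔽_l ⊆ 𝔽_l^{⋊±}` of the `𝔽_l^{⋊±}`-symmetry. PROVED for `l ≥ 3` (witness: `|1| = |−1|` but
`|1 + 1| ≠ |−1 + 1| = |0|`); false for `l = 2`, where `−1 = 1`; in IUT `l ≥ 5`.
[claim: Mochizuki2012, status: disputed] -/
theorem transl_not_compatible_flAbs (hl : 2 < l) :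
    ¬ ∀ a x y : ZMod l, FlAbs.mk l x = FlAbs.mk l y → FlAbs.mk l (x + a) = FlAbs.mk l (y + a) := by
  intro h
  have h1 : FlAbs.mk l (1 : ZMod l) = FlAbs.mk l (-1) := FlAbs.mk_eq_mk_iff.2 (Or.inr (neg_neg 1).symm)
  have h2 := h 1 1 (-1) h1
  rw [neg_add_cancel, FlAbs.mk_eq_mk_iff, neg_zero, or_self] at h2
  have h3 : ((2 : ℕ) : ZMod l) = 0 := by rw [Nat.cast_ofNat]; rw [← h2]; norm_num
  rw [ZMod.natCast_eq_zero_iff] at h3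
  exact absurd (Nat.le_of_dvd two_pos h3) (not_le.mpr hl)

/-- Contrast to [IUTchI] Rmk. 6.12.4 (iii) p. 179 (elementary; implicit in the use of `|𝔽_l|`-labels for
the multiplicative theory of §4, Ex. 4.4 (i)): the MULTIPLICATIVE action of `𝔽_l^×` on `𝔽_l` IS
compatible with `𝔽_l ↠ |𝔽_l|`. [claim: Mochizuki2012, status: disputed] -/
theorem units_mul_compatible_flAbs (u : (ZMod l)ˣ) {x y : ZMod l} (h : FlAbs.mk l x = FlAbs.mk l y) :
    FlAbs.mk l ((u : ZMod l) * x) = FlAbs.mk l ((u : ZMod l) * y) := by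
  rw [FlAbs.mk_eq_mk_iff] at h ⊢
  rcases h with rfl | rfl
  · exact Or.inl rfl
  · exact Or.inr (mul_neg _ _)

/-- The criterion behind [IUTchI] Rmk. 6.12.4 (iii) p. 179: a self-map `f` of `𝔽_l` is compatible with
`𝔽_l ↠ |𝔽_l|` iff `|f(−x)| = |f(x)|` for all `x` — translations `z ↦ z + a` (`a ≠ 0`, `l` odd) fail
this, sign-commuting maps satisfy it. [claim: Mochizuki2012, status: disputed] -/
theorem flAbs_descends_iff (f : ZMod l → ZMod l) :
    (∀ x y : ZMod l, FlAbs.mk l x = FlAbs.mk l y → FlAbs.mk l (f x) = FlAbs.mk l (f y)) ↔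
      ∀ x : ZMod l, FlAbs.mk l (f (-x)) = FlAbs.mk l (f x) := by
  constructor
  · intro h x; exact h _ _ (FlAbs.mk_eq_mk_iff.2 (Or.inr rfl))
  · intro h x y hxy
    rcases FlAbs.mk_eq_mk_iff.1 hxy with rfl | rfl
    · rfl
    · exact h y

end Rmk6124

end Literature.IUT.HodgeTheaters
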